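import Summits.Ventures.CertifiedManyBodySolver.Downfold.EmeryBoxesLa214Slices
import Summits.Ventures.CertifiedManyBodySolver.Downfold.EmeryBoxesLa214M15Slices
import Summits.Ventures.CertifiedManyBodySolver.Downfold.EmeryBoxesKSlicesA
import Summits.Ventures.CertifiedManyBodySolver.Downfold.EmeryBoxesLa214V122
import Summits.Ventures.CertifiedManyBodySolver.Downfold.EmeryFillingRepoint
import Summits.Ventures.CertifiedManyBodySolver.Downfold.ParameterBoxRebase
import HarnessLib

/-!
# `V_pd` is not a seam coordinate: the generic two-way door `holdsOn_update_Vpd_iff`, and the La-214 U-SLICES' `V_pd` entry re-pointed to box #18 §OF-RECORD v1.18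
# ([0.57, 1.88] → [0.57, 2.68]) — `…VpdV118` variants of the seven La-214 / LSCO x = 1/8 slices, each ONE definition with its seam words provably IDENTICAL to the slice of record

Venture CertifiedManyBodySolver, cell `pub/hubbard-downfold` (S1 = ROUTER), seat hubbard-downfold-mod-4 (S1/S2 Emery seam); namespace
`Summit.Ventures.CertifiedManyBodySolver.Downfold`. The La₂CuO₄ 3BE companion's interaction rows were re-issued by source in `EmeryBoxesLa214V122` (box #18 §OF-RECORD
v1.18: V_pd [0.57, 1.88] → [0.57, 2.68] = `la214Emery_Vpd_v118`; v1.22: U_dd). The U-SLICES of record (`EmeryBoxesLa214Slices` cLDA / cRPA / Kung, `EmeryBoxesKSlicesA` (K) #1,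
`EmeryBoxesLa214M15Slices` ×3) PIN their (U_dd, U_pp) pairs — untouched by the U re-issue — but still carry the companion's OLD `V_pd` entry `la214Emery_Vpd` «as the companion».
`V_pd` enters the decorated model at mean field / V := 0: it is NOT one of the six delivered seam coordinates (t_pd, t_pp, ε_d, ε_p, U_d, U_p). THIS FILE proves that once
(`emeryLineCoords_update_Vpd`, `holdsOn_update_Vpd_iff` — any Emery box, any re-pointing of `.Vpd`, any seam-shape word, BOTH directions; kernel `EmeryFillingRepoint`) and
then types, per slice `E`, the variant `E VpdV118 := Function.update E .Vpd (some la214Emery_Vpd_v118)` with (i) `_seam_iff` — every energy floor / vertex word / Lipschitz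
transport typed on `E` holds on the variant and conversely (so NO vertex check is redone), (ii) `E_refines_VpdV118` — old ⊑ new (the old V row sits inside the new) for words that DO
read `V_pd`, (iii) the accessor of the new entry. After this file every typed La-214 3BE object has a v1.18/v1.22 twin; EMERY-LINE-ROWS v3.11 rows 3–6 already print [0.57, 2.68].
Everything PROVED (0 sorry); SCREENING-GRADE inputs; nothing about the material is certified; words of record unchanged.
-/

namespace Summit.Ventures.CertifiedManyBodySolver.Downfold

open NonemptyInterval Literature.MathematicalPhysics.QuantumLattice

/-! ### Generic: the seam does not read `Vpd` -/

/-- The delivered six-vector does not read the `V_pd` coordinate (V at mean field / V := 0 in the decorated model). [folklore] -/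
theorem emeryLineCoords_update_Vpd (εp : ℝ) (p : EmeryCoord → ℝ) (v : ℝ) :
    emeryLineCoords εp (Function.update p .Vpd v) = emeryLineCoords εp p := by
  ext i; fin_cases i <;> simp [emeryLineCoords]

/-- **Seam-shape words transfer both ways across ANY re-pointing of the `Vpd` entry.** [folklore] -/
theorem holdsOn_update_Vpd_iff (E : EmeryBox) (x : Option Entry) (εp : ℝ) (W : (Fin 6 → ℝ) → Prop) :
    HoldsOn (fun p : EmeryCoord → ℝ => W (emeryLineCoords εp p)) (Function.update E .Vpd x) ↔
      HoldsOn (fun p : EmeryCoord → ℝ => W (emeryLineCoords εp p)) E :=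
  holdsOn_update_iff_of_ignoresCoord (Box.ignoresCoord_comp (fun p v => emeryLineCoords_update_Vpd εp p v) W) E x

/-! ### The La-214 / LSCO x = 1/8 U-slices with `V_pd` := [0.57, 2.68] (v1.18) -/

/-- **`emeryBoxLa214CLDAVpdV118`** = the La₂CuO₄ U-slice «cLDA» (10.5, 4.0) (`emeryBoxLa214CLDA`, slice of record) with its `V_pd` entry re-pointed to `la214Emery_Vpd_v118` [0.57, 2.68] (box #18 §OF-RECORD v1.18). [folklore] -/
noncomputable def emeryBoxLa214CLDAVpdV118 : EmeryBox := Function.update emeryBoxLa214CLDA .Vpd (some la214Emery_Vpd_v118)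

/-- Accessor: the re-pointed `V_pd` entry. [folklore] -/
theorem emeryBoxLa214CLDAVpdV118_Vpd : emeryBoxLa214CLDAVpdV118 .Vpd = some la214Emery_Vpd_v118 := Function.update_self _ _ _

/-- **Every seam-shape word holds on `emeryBoxLa214CLDAVpdV118` iff it holds on `emeryBoxLa214CLDA`** — the slice's energy floors and vertex words carry over verbatim, no re-check. [folklore] -/
theorem emeryBoxLa214CLDAVpdV118_seam_iff (εp : ℝ) (W : (Fin 6 → ℝ) → Prop) :
    HoldsOn (fun p : EmeryCoord → ℝ => W (emeryLineCoords εp p)) emeryBoxLa214CLDAVpdV118 ↔ HoldsOn (fun p : EmeryCoord → ℝ => W (emeryLineCoords εp p)) emeryBoxLa214CLDA :=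
  holdsOn_update_Vpd_iff emeryBoxLa214CLDA (some la214Emery_Vpd_v118) εp W

/-- **Old ⊑ new** ([0.57, 1.88] ⊆ [0.57, 2.68] at `V_pd`, every other entry equal): words that DO read `V_pd`, typed on the variant, transfer down to the slice of record. [folklore] -/
theorem emeryBoxLa214CLDA_refines_VpdV118 : emeryBoxLa214CLDA.Refines emeryBoxLa214CLDAVpdV118 := by
  intro p hp i f hi
  by_cases hic : i = EmeryCoord.Vpd
  · subst hic
    rw [emeryBoxLa214CLDAVpdV118_Vpd, Option.some.injEq] at hi
    subst hi
    have hold : emeryBoxLa214CLDA .Vpd = some la214Emery_Vpd := by simp [emeryBoxLa214CLDA, emeryBoxLa214CLDASrc, Function.update]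
    exact Entry.mem_ofEnds_mono (by norm_num) (by norm_num) ((hp _ _ hold))
  · exact hp i f (by simpa [emeryBoxLa214CLDAVpdV118, Function.update_of_ne hic] using hi)

/-- **`emeryBoxLa214CRPAVpdV118`** = the La₂CuO₄ U-slice «cRPA» (7.00, 4.64) (`emeryBoxLa214CRPA`, slice of record) with its `V_pd` entry re-pointed to `la214Emery_Vpd_v118` [0.57, 2.68] (box #18 §OF-RECORD v1.18). [folklore] -/
noncomputable def emeryBoxLa214CRPAVpdV118 : EmeryBox := Function.update emeryBoxLa214CRPA .Vpd (some la214Emery_Vpd_v118)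

/-- Accessor: the re-pointed `V_pd` entry. [folklore] -/
theorem emeryBoxLa214CRPAVpdV118_Vpd : emeryBoxLa214CRPAVpdV118 .Vpd = some la214Emery_Vpd_v118 := Function.update_self _ _ _

/-- **Every seam-shape word holds on `emeryBoxLa214CRPAVpdV118` iff it holds on `emeryBoxLa214CRPA`** — the slice's energy floors and vertex words carry over verbatim, no re-check. [folklore] -/
theorem emeryBoxLa214CRPAVpdV118_seam_iff (εp : ℝ) (W : (Fin 6 → ℝ) → Prop) :
    HoldsOn (fun p : EmeryCoord → ℝ => W (emeryLineCoords εp p)) emeryBoxLa214CRPAVpdV118 ↔ HoldsOn (fun p : EmeryCoord → ℝ => W (emeryLineCoords εp p)) emeryBoxLa214CRPA :=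
  holdsOn_update_Vpd_iff emeryBoxLa214CRPA (some la214Emery_Vpd_v118) εp W

/-- **Old ⊑ new** ([0.57, 1.88] ⊆ [0.57, 2.68] at `V_pd`, every other entry equal): words that DO read `V_pd`, typed on the variant, transfer down to the slice of record. [folklore] -/
theorem emeryBoxLa214CRPA_refines_VpdV118 : emeryBoxLa214CRPA.Refines emeryBoxLa214CRPAVpdV118 := by
  intro p hp i f hi
  by_cases hic : i = EmeryCoord.Vpd
  · subst hic
    rw [emeryBoxLa214CRPAVpdV118_Vpd, Option.some.injEq] at hi
    subst hi
    have hold : emeryBoxLa214CRPA .Vpd = some la214Emery_Vpd := by simp [emeryBoxLa214CRPA, emeryBoxLa214CRPASrc, Function.update]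
    exact Entry.mem_ofEnds_mono (by norm_num) (by norm_num) ((hp _ _ hold))
  · exact hp i f (by simpa [emeryBoxLa214CRPAVpdV118, Function.update_of_ne hic] using hi)

/-- **`emeryBoxLa214KungVpdV118`** = the La₂CuO₄ U-slice «Kung canonical» (8.5, 4.1) (`emeryBoxLa214Kung`, slice of record) with its `V_pd` entry re-pointed to `la214Emery_Vpd_v118` [0.57, 2.68] (box #18 §OF-RECORD v1.18). [folklore] -/
noncomputable def emeryBoxLa214KungVpdV118 : EmeryBox := Function.update emeryBoxLa214Kung .Vpd (some la214Emery_Vpd_v118)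

/-- Accessor: the re-pointed `V_pd` entry. [folklore] -/
theorem emeryBoxLa214KungVpdV118_Vpd : emeryBoxLa214KungVpdV118 .Vpd = some la214Emery_Vpd_v118 := Function.update_self _ _ _

/-- **Every seam-shape word holds on `emeryBoxLa214KungVpdV118` iff it holds on `emeryBoxLa214Kung`** — the slice's energy floors and vertex words carry over verbatim, no re-check. [folklore] -/
theorem emeryBoxLa214KungVpdV118_seam_iff (εp : ℝ) (W : (Fin 6 → ℝ) → Prop) :
    HoldsOn (fun p : EmeryCoord → ℝ => W (emeryLineCoords εp p)) emeryBoxLa214KungVpdV118 ↔ HoldsOn (fun p : EmeryCoord → ℝ => W (emeryLineCoords εp p)) emeryBoxLa214Kung :=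
  holdsOn_update_Vpd_iff emeryBoxLa214Kung (some la214Emery_Vpd_v118) εp W

/-- **Old ⊑ new** ([0.57, 1.88] ⊆ [0.57, 2.68] at `V_pd`, every other entry equal): words that DO read `V_pd`, typed on the variant, transfer down to the slice of record. [folklore] -/
theorem emeryBoxLa214Kung_refines_VpdV118 : emeryBoxLa214Kung.Refines emeryBoxLa214KungVpdV118 := by
  intro p hp i f hi
  by_cases hic : i = EmeryCoord.Vpd
  · subst hic
    rw [emeryBoxLa214KungVpdV118_Vpd, Option.some.injEq] at hi
    subst hi
    have hold : emeryBoxLa214Kung .Vpd = some la214Emery_Vpd := by simp [emeryBoxLa214Kung, emeryBoxLa214KungSrc, Function.update]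
    exact Entry.mem_ofEnds_mono (by norm_num) (by norm_num) ((hp _ _ hold))
  · exact hp i f (by simpa [emeryBoxLa214KungVpdV118, Function.update_of_ne hic] using hi)

/-- **`emeryBoxLa214K26VpdV118`** = the La₂CuO₄ U-slice «(K) #1» (4.83, 4.538) (`emeryBoxLa214K26`, slice of record) with its `V_pd` entry re-pointed to `la214Emery_Vpd_v118` [0.57, 2.68] (box #18 §OF-RECORD v1.18). [folklore] -/
noncomputable def emeryBoxLa214K26VpdV118 : EmeryBox := Function.update emeryBoxLa214K26 .Vpd (some la214Emery_Vpd_v118)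

/-- Accessor: the re-pointed `V_pd` entry. [folklore] -/
theorem emeryBoxLa214K26VpdV118_Vpd : emeryBoxLa214K26VpdV118 .Vpd = some la214Emery_Vpd_v118 := Function.update_self _ _ _

/-- **Every seam-shape word holds on `emeryBoxLa214K26VpdV118` iff it holds on `emeryBoxLa214K26`** — the slice's energy floors and vertex words carry over verbatim, no re-check. [folklore] -/
theorem emeryBoxLa214K26VpdV118_seam_iff (εp : ℝ) (W : (Fin 6 → ℝ) → Prop) :
    HoldsOn (fun p : EmeryCoord → ℝ => W (emeryLineCoords εp p)) emeryBoxLa214K26VpdV118 ↔ HoldsOn (fun p : EmeryCoord → ℝ => W (emeryLineCoords εp p)) emeryBoxLa214K26 :=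
  holdsOn_update_Vpd_iff emeryBoxLa214K26 (some la214Emery_Vpd_v118) εp W

/-- **Old ⊑ new** ([0.57, 1.88] ⊆ [0.57, 2.68] at `V_pd`, every other entry equal): words that DO read `V_pd`, typed on the variant, transfer down to the slice of record. [folklore] -/
theorem emeryBoxLa214K26_refines_VpdV118 : emeryBoxLa214K26.Refines emeryBoxLa214K26VpdV118 := by
  intro p hp i f hi
  by_cases hic : i = EmeryCoord.Vpd
  · subst hic
    rw [emeryBoxLa214K26VpdV118_Vpd, Option.some.injEq] at hi
    subst hi
    have hold : emeryBoxLa214K26 .Vpd = some la214Emery_Vpd := by simp [emeryBoxLa214K26, emeryBoxLa214K26Src, Function.update]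
    exact Entry.mem_ofEnds_mono (by norm_num) (by norm_num) ((hp _ _ hold))
  · exact hp i f (by simpa [emeryBoxLa214K26VpdV118, Function.update_of_ne hic] using hi)

/-- **`emeryBoxLa214M15CLDAVpdV118`** = the LSCO x = 1/8 U-slice «cLDA» (`emeryBoxLa214M15CLDA`, slice of record) with its `V_pd` entry re-pointed to `la214Emery_Vpd_v118` [0.57, 2.68] (box #18 §OF-RECORD v1.18). [folklore] -/
noncomputable def emeryBoxLa214M15CLDAVpdV118 : EmeryBox := Function.update emeryBoxLa214M15CLDA .Vpd (some la214Emery_Vpd_v118)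

/-- Accessor: the re-pointed `V_pd` entry. [folklore] -/
theorem emeryBoxLa214M15CLDAVpdV118_Vpd : emeryBoxLa214M15CLDAVpdV118 .Vpd = some la214Emery_Vpd_v118 := Function.update_self _ _ _

/-- **Every seam-shape word holds on `emeryBoxLa214M15CLDAVpdV118` iff it holds on `emeryBoxLa214M15CLDA`** — the slice's energy floors and vertex words carry over verbatim, no re-check. [folklore] -/
theorem emeryBoxLa214M15CLDAVpdV118_seam_iff (εp : ℝ) (W : (Fin 6 → ℝ) → Prop) :
    HoldsOn (fun p : EmeryCoord → ℝ => W (emeryLineCoords εp p)) emeryBoxLa214M15CLDAVpdV118 ↔ HoldsOn (fun p : EmeryCoord → ℝ => W (emeryLineCoords εp p)) emeryBoxLa214M15CLDA :=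
  holdsOn_update_Vpd_iff emeryBoxLa214M15CLDA (some la214Emery_Vpd_v118) εp W

/-- **Old ⊑ new** ([0.57, 1.88] ⊆ [0.57, 2.68] at `V_pd`, every other entry equal): words that DO read `V_pd`, typed on the variant, transfer down to the slice of record. [folklore] -/
theorem emeryBoxLa214M15CLDA_refines_VpdV118 : emeryBoxLa214M15CLDA.Refines emeryBoxLa214M15CLDAVpdV118 := by
  intro p hp i f hi
  by_cases hic : i = EmeryCoord.Vpd
  · subst hic
    rw [emeryBoxLa214M15CLDAVpdV118_Vpd, Option.some.injEq] at hi
    subst hi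
    have hold : emeryBoxLa214M15CLDA .Vpd = some la214Emery_Vpd := by simp [emeryBoxLa214M15CLDA, emeryBoxLa214M15CLDASrc, Function.update]
    exact Entry.mem_ofEnds_mono (by norm_num) (by norm_num) ((hp _ _ hold))
  · exact hp i f (by simpa [emeryBoxLa214M15CLDAVpdV118, Function.update_of_ne hic] using hi)

/-- **`emeryBoxLa214M15CRPAVpdV118`** = the LSCO x = 1/8 U-slice «cRPA» (`emeryBoxLa214M15CRPA`, slice of record) with its `V_pd` entry re-pointed to `la214Emery_Vpd_v118` [0.57, 2.68] (box #18 §OF-RECORD v1.18). [folklore] -/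
noncomputable def emeryBoxLa214M15CRPAVpdV118 : EmeryBox := Function.update emeryBoxLa214M15CRPA .Vpd (some la214Emery_Vpd_v118)

/-- Accessor: the re-pointed `V_pd` entry. [folklore] -/
theorem emeryBoxLa214M15CRPAVpdV118_Vpd : emeryBoxLa214M15CRPAVpdV118 .Vpd = some la214Emery_Vpd_v118 := Function.update_self _ _ _

/-- **Every seam-shape word holds on `emeryBoxLa214M15CRPAVpdV118` iff it holds on `emeryBoxLa214M15CRPA`** — the slice's energy floors and vertex words carry over verbatim, no re-check. [folklore] -/
theorem emeryBoxLa214M15CRPAVpdV118_seam_iff (εp : ℝ) (W : (Fin 6 → ℝ) → Prop) :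
    HoldsOn (fun p : EmeryCoord → ℝ => W (emeryLineCoords εp p)) emeryBoxLa214M15CRPAVpdV118 ↔ HoldsOn (fun p : EmeryCoord → ℝ => W (emeryLineCoords εp p)) emeryBoxLa214M15CRPA :=
  holdsOn_update_Vpd_iff emeryBoxLa214M15CRPA (some la214Emery_Vpd_v118) εp W

/-- **Old ⊑ new** ([0.57, 1.88] ⊆ [0.57, 2.68] at `V_pd`, every other entry equal): words that DO read `V_pd`, typed on the variant, transfer down to the slice of record. [folklore] -/
theorem emeryBoxLa214M15CRPA_refines_VpdV118 : emeryBoxLa214M15CRPA.Refines emeryBoxLa214M15CRPAVpdV118 := by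
  intro p hp i f hi
  by_cases hic : i = EmeryCoord.Vpd
  · subst hic
    rw [emeryBoxLa214M15CRPAVpdV118_Vpd, Option.some.injEq] at hi
    subst hi
    have hold : emeryBoxLa214M15CRPA .Vpd = some la214Emery_Vpd := by simp [emeryBoxLa214M15CRPA, emeryBoxLa214M15CRPASrc, Function.update]
    exact Entry.mem_ofEnds_mono (by norm_num) (by norm_num) ((hp _ _ hold))
  · exact hp i f (by simpa [emeryBoxLa214M15CRPAVpdV118, Function.update_of_ne hic] using hi)

/-- **`emeryBoxLa214M15KungVpdV118`** = the LSCO x = 1/8 U-slice «Kung canonical» (`emeryBoxLa214M15Kung`, slice of record) with its `V_pd` entry re-pointed to `la214Emery_Vpd_v118` [0.57, 2.68] (box #18 §OF-RECORD v1.18). [folklore] -/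
noncomputable def emeryBoxLa214M15KungVpdV118 : EmeryBox := Function.update emeryBoxLa214M15Kung .Vpd (some la214Emery_Vpd_v118)

/-- Accessor: the re-pointed `V_pd` entry. [folklore] -/
theorem emeryBoxLa214M15KungVpdV118_Vpd : emeryBoxLa214M15KungVpdV118 .Vpd = some la214Emery_Vpd_v118 := Function.update_self _ _ _

/-- **Every seam-shape word holds on `emeryBoxLa214M15KungVpdV118` iff it holds on `emeryBoxLa214M15Kung`** — the slice's energy floors and vertex words carry over verbatim, no re-check. [folklore] -/
theorem emeryBoxLa214M15KungVpdV118_seam_iff (εp : ℝ) (W : (Fin 6 → ℝ) → Prop) :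
    HoldsOn (fun p : EmeryCoord → ℝ => W (emeryLineCoords εp p)) emeryBoxLa214M15KungVpdV118 ↔ HoldsOn (fun p : EmeryCoord → ℝ => W (emeryLineCoords εp p)) emeryBoxLa214M15Kung :=
  holdsOn_update_Vpd_iff emeryBoxLa214M15Kung (some la214Emery_Vpd_v118) εp W

/-- **Old ⊑ new** ([0.57, 1.88] ⊆ [0.57, 2.68] at `V_pd`, every other entry equal): words that DO read `V_pd`, typed on the variant, transfer down to the slice of record. [folklore] -/
theorem emeryBoxLa214M15Kung_refines_VpdV118 : emeryBoxLa214M15Kung.Refines emeryBoxLa214M15KungVpdV118 := by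
  intro p hp i f hi
  by_cases hic : i = EmeryCoord.Vpd
  · subst hic
    rw [emeryBoxLa214M15KungVpdV118_Vpd, Option.some.injEq] at hi
    subst hi
    have hold : emeryBoxLa214M15Kung .Vpd = some la214Emery_Vpd := by simp [emeryBoxLa214M15Kung, emeryBoxLa214M15KungSrc, Function.update]
    exact Entry.mem_ofEnds_mono (by norm_num) (by norm_num) ((hp _ _ hold))
  · exact hp i f (by simpa [emeryBoxLa214M15KungVpdV118, Function.update_of_ne hic] using hi)

end Summit.Ventures.CertifiedManyBodySolver.Downfold
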